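import Summits.Ventures.YMGap.Thresholds.TwistedBochnerIntegrated
import Summits.Ventures.YMGap.Thresholds.OneLinkVarianceSDCentred
import HarnessLib

/-!
# Venture YMGap — the twisted one-link Poincaré constant for every `SU(N)`: comparison with Bakry–Émery, the radius cap, `SU(4)` rows

HONEST FRAMING.  Venture file of the cell `pub-ymgap` (QuantumFields programme), seat engine-2 (g12); 0 compute.  Explicit
STRONG-COUPLING constants for ONE tilted Haar law `ν_B(dg) ∝ exp(N Re tr(gB)) dg` on `SU(N)`; NOT weak coupling, NOT a continuum
statement, NOT a Yang–Mills mass-gap claim.  Pure arithmetic over `TwistedBochnerIntegrated.oneLinkPoincareSUN_twisted`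
(`K_N(R) = N(N²−1)/(2(N²−2)) − ((N²−1)/N)R − ((N²−1)/(2N(N²−2)))R²`):
* `bakryEmery_lt_twisted_sun`: `N(1/2 − R) < K_N(R)` for every `N ≥ 2`, `0 ≤ R ≤ 1/2` (the twisted constant is STRICTLY better everywhere);
* `oneLinkPoincareSUN_twisted_half`, `…_beyond_half`: `OneLinkPoincareSUN N (1/2) (8N/7)` and `OneLinkPoincareSUN N (1/2 + 1/(2N²)) (8N/3)`
  for every `N ≥ 2` — Bakry–Émery (`oneLinkPoincareSUN_bakryEmery`) gives nothing at `R ≥ 1/2`; the twisted cap is `√((N²−2)² + N²) − (N²−2)`;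
* `SU(4)`: `OneLinkPoincareSUN 4 (3/10) 1`, `… 4 (2/5) (50/31)`, `… 4 (1/2) (64/15)` (Bakry–Émery: `5/4`, `5/2`, none);
* `suN_oneLinkKRModulus_twisted_of_le`: the Kantorovich–Rubinstein modulus `OneLinkKRModulus N R K` for EVERY `N ≥ 2` from the twisted constant × engine-2 g10's
  centred Schwinger–Dyson variance `N(τ + τ³N²R²/(16(τ−1)))` (`oneLinkVarianceBound_sdc`) through pub-balaban's door `√(c·v)`: `N(τ + τ³N²R²/(16(τ−1))) ≤ K_p K²`;
  g10's `oneLinkKRModulus_pv2_of_le` is the same on Bakry–Émery's `K_p = N(1/2 − R)`, `R < 1/2` — here no radius cap below `√((N²−2)² + N²) − (N²−2)`;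
  `SU(4)` instance `OneLinkKRModulus 4 (1/2) (15/2)` (a modulus AT the Bakry–Émery cap; no door closes there — recorded for completeness, not a row).
NOT CLAIMED: any `N`-uniform gain; anything for `N = 2, 3` beyond J-SC13 / g11; the certified column; sharpness.

References: Bakry–Émery LNM 1123 (1985); Shen–Zhu–Zhu CMP 400 (2023) Lemma 4.1; the tree's `StrongCouplingPoincareDoorSUN`; cell note
`HOME/pub-ymgap-engine-2/TWISTED-BOCHNER-SUN.md`.
-/

noncomputable section

open scoped Matrix ComplexConjugate BigOperators Matrix.Norms.Frobenius ContDiff Topology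
open Matrix Complex Finset MeasureTheory ProbabilityTheory
open Literature.MathematicalPhysics.QuantumFieldTheory
open Literature.MathematicalPhysics.QuantumFieldTheory.SUNBakryEmery
open Literature.MathematicalPhysics.QuantumFieldTheory.Balaban1983to89.StrongCouplingDobrushinWindow (OneLinkKRModulus)
open Summit.QuantumFields.BalabanUV.InfraRed.StrongCouplingVarianceDoorSUN (OneLinkVarianceBound)
open Summit.QuantumFields.BalabanUV.InfraRed.StrongCouplingPoincareDoorSUN (OneLinkPoincareSUN oneLinkKRModulus_of_poincare_of_varianceBound)
open Summit.Ventures.YMGap.OneLinkVarianceSDC (oneLinkVarianceBound_sdc)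

namespace Summit.Ventures.YMGap.TwistedBochner

variable {N : ℕ}

/-! ### 1. Against Bakry–Émery: strictly larger at every `N` and `R`, and alive at and beyond `R = 1/2` -/

/-- **The twisted constant dominates Bakry–Émery's for every `N ≥ 2` and `0 ≤ R ≤ 1/2`**:
`N(1/2 − R) < N(N²−1)/(2(N²−2)) − ((N²−1)/N)R − ((N²−1)/(2N(N²−2)))R²` (the difference is
`(N² + 2(N²−2)R − (N²−1)R²)/(2N(N²−2)) > 0`). [folklore] -/
theorem bakryEmery_lt_twisted_sun (hN : 2 ≤ N) {R : ℝ} (hR0 : 0 ≤ R) (hR : R ≤ 1 / 2) :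
    (N : ℝ) * (1 / 2 - R) <
      (N : ℝ) * ((N : ℝ) ^ 2 - 1) / (2 * ((N : ℝ) ^ 2 - 2)) - ((N : ℝ) ^ 2 - 1) / N * R -
        ((N : ℝ) ^ 2 - 1) / (2 * N * ((N : ℝ) ^ 2 - 2)) * R ^ 2 := by
  have hN2 : (2 : ℝ) ≤ N := by exact_mod_cast hN
  have hNpos : (0 : ℝ) < N := by positivity
  have hn2 : 0 < (N : ℝ) ^ 2 - 2 := by nlinarith
  rw [← sub_pos]
  have e : (N : ℝ) * ((N : ℝ) ^ 2 - 1) / (2 * ((N : ℝ) ^ 2 - 2)) - ((N : ℝ) ^ 2 - 1) / N * R -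
        ((N : ℝ) ^ 2 - 1) / (2 * N * ((N : ℝ) ^ 2 - 2)) * R ^ 2 - (N : ℝ) * (1 / 2 - R) =
      ((N : ℝ) ^ 2 + 2 * ((N : ℝ) ^ 2 - 2) * R - ((N : ℝ) ^ 2 - 1) * R ^ 2) / (2 * N * ((N : ℝ) ^ 2 - 2)) := by
    field_simp
    ring
  rw [e]
  have hR2 : R ^ 2 ≤ 1 / 4 := by nlinarith
  have h1 : 0 ≤ 2 * ((N : ℝ) ^ 2 - 2) * R := by positivity
  have h2 : ((N : ℝ) ^ 2 - 1) * R ^ 2 ≤ ((N : ℝ) ^ 2 - 1) * (1 / 4) := mul_le_mul_of_nonneg_left hR2 (by nlinarith)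
  exact div_pos (by nlinarith) (by positivity)

/-- **At the Bakry–Émery cap** `R = 1/2` (where Bakry–Émery gives nothing), for every `N ≥ 2`: `OneLinkPoincareSUN N (1/2) (8N/7)`
(`K = 7/(8N) ≤ 7(N²−1)/(8N(N²−2))`). [folklore] -/
theorem oneLinkPoincareSUN_twisted_half (hN : 2 ≤ N) : OneLinkPoincareSUN N (1 / 2) (8 * N / 7) := by
  have hN2 : (2 : ℝ) ≤ N := by exact_mod_cast hN
  have hNpos : (0 : ℝ) < N := by positivity
  have hn2 : 0 < (N : ℝ) ^ 2 - 2 := by nlinarith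
  have hK : (0 : ℝ) < 7 / (8 * N) := by positivity
  have h := oneLinkPoincareSUN_twisted hN (R := 1 / 2) hK (by
    rw [← sub_nonneg]
    have e : (N : ℝ) * ((N : ℝ) ^ 2 - 1) / (2 * ((N : ℝ) ^ 2 - 2)) -
        (7 / (8 * N) + ((N : ℝ) ^ 2 - 1) / N * (1 / 2) + ((N : ℝ) ^ 2 - 1) / (2 * N * ((N : ℝ) ^ 2 - 2)) * (1 / 2) ^ 2) =
        7 / (8 * N * ((N : ℝ) ^ 2 - 2)) := by
      field_simp
      ring
    rw [e]
    positivity)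
  have e : 1 / (7 / (8 * (N : ℝ))) = 8 * N / 7 := by
    field_simp
  rw [e] at h
  exact h

/-- **Beyond the Bakry–Émery cap**, for every `N ≥ 2`: `OneLinkPoincareSUN N (1/2 + 1/(2N²)) (8N/3)`
(`K = 3/(8N)`; the slack is `(9N⁴ − 7N² + 1)/(8N⁵(N²−2)) > 0`). [folklore] -/
theorem oneLinkPoincareSUN_twisted_beyond_half (hN : 2 ≤ N) : OneLinkPoincareSUN N (1 / 2 + 1 / (2 * (N : ℝ) ^ 2)) (8 * N / 3) := by
  have hN2 : (2 : ℝ) ≤ N := by exact_mod_cast hN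
  have hNpos : (0 : ℝ) < N := by positivity
  have hn2 : 0 < (N : ℝ) ^ 2 - 2 := by nlinarith
  have hK : (0 : ℝ) < 3 / (8 * N) := by positivity
  have h := oneLinkPoincareSUN_twisted hN (R := 1 / 2 + 1 / (2 * (N : ℝ) ^ 2)) hK (by
    rw [← sub_nonneg]
    have e : (N : ℝ) * ((N : ℝ) ^ 2 - 1) / (2 * ((N : ℝ) ^ 2 - 2)) -
        (3 / (8 * N) + ((N : ℝ) ^ 2 - 1) / N * (1 / 2 + 1 / (2 * (N : ℝ) ^ 2)) +
          ((N : ℝ) ^ 2 - 1) / (2 * N * ((N : ℝ) ^ 2 - 2)) * (1 / 2 + 1 / (2 * (N : ℝ) ^ 2)) ^ 2) =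
        (9 * (N : ℝ) ^ 4 - 7 * (N : ℝ) ^ 2 + 1) / (8 * (N : ℝ) ^ 5 * ((N : ℝ) ^ 2 - 2)) := by
      field_simp
      ring
    rw [e]
    exact div_nonneg (by nlinarith) (by positivity))
  have e : 1 / (3 / (8 * (N : ℝ))) = 8 * N / 3 := by
    field_simp
  rw [e] at h
  exact h

/-! ### 2. `SU(4)` instances (Bakry–Émery: `1/(4(1/2 − R))`) -/

/-- `OneLinkPoincareSUN 4 (3/10) 1` (`K = 1 ≤ 15/7 − 9/8 − 27/2240`; Bakry–Émery `K = 4/5`). [folklore] -/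
theorem oneLinkPoincareSUN_su4_twisted_threeTenths : OneLinkPoincareSUN 4 (3 / 10) 1 := by
  have h := oneLinkPoincareSUN_twisted (N := 4) (by norm_num) (R := 3 / 10) (K := 1) one_pos (by norm_num)
  rwa [div_one] at h

/-- `OneLinkPoincareSUN 4 (2/5) (50/31)` (`K = 31/50 ≤ 15/7 − 3/2 − 3/140`; Bakry–Émery `K = 2/5`). [folklore] -/
theorem oneLinkPoincareSUN_su4_twisted_twoFifths : OneLinkPoincareSUN 4 (2 / 5) (50 / 31) := by
  have h := oneLinkPoincareSUN_twisted (N := 4) (by norm_num) (R := 2 / 5) (K := 31 / 50) (by norm_num) (by norm_num)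
  norm_num at h ⊢
  exact h

/-- `OneLinkPoincareSUN 4 (1/2) (64/15)` (`K = 15/64 = 15/7 − 15/8 − 15/448`; Bakry–Émery: nothing at `R = 1/2`). [folklore] -/
theorem oneLinkPoincareSUN_su4_twisted_half : OneLinkPoincareSUN 4 (1 / 2) (64 / 15) := by
  have h := oneLinkPoincareSUN_twisted (N := 4) (by norm_num) (R := 1 / 2) (K := 15 / 64) (by norm_num) (by norm_num)
  norm_num at h ⊢
  exact h

/-! ### 3. The every-`N` Kantorovich–Rubinstein modulus on the twisted constant -/

/-- **`OneLinkKRModulus N R K` FOR EVERY `N ≥ 2` on the twisted constant** (hypothesis-free): for `τ > 1`, `0 < K_p` with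
`K_p + ((N²−1)/N)R + ((N²−1)/(2N(N²−2)))R² ≤ N(N²−1)/(2(N²−2))` and `K ≥ 0` with `N(τ + τ³N²R²/(16(τ−1))) ≤ K_p K²`:  `OneLinkKRModulus N R K`
(pub-balaban's door `√(c·v)` on `c = 1/K_p` (`oneLinkPoincareSUN_twisted`) and `v = K_p K² ≥` engine-2 g10's centred Schwinger–Dyson variance
(`oneLinkVarianceBound_sdc`)). [folklore] -/
theorem suN_oneLinkKRModulus_twisted_of_le (hN : 2 ≤ N) {R τ K Kp : ℝ} (hτ : 1 < τ) (hKp : 0 < Kp)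
    (hKpR : Kp + ((N : ℝ) ^ 2 - 1) / N * R + ((N : ℝ) ^ 2 - 1) / (2 * N * ((N : ℝ) ^ 2 - 2)) * R ^ 2 ≤
      (N : ℝ) * ((N : ℝ) ^ 2 - 1) / (2 * ((N : ℝ) ^ 2 - 2)))
    (hK0 : 0 ≤ K) (hK : (N : ℝ) * (τ + τ ^ 3 * (N : ℝ) ^ 2 * R ^ 2 / (16 * (τ - 1))) ≤ Kp * K ^ 2) : OneLinkKRModulus N R K := by
  have hP : OneLinkPoincareSUN N R (1 / Kp) := oneLinkPoincareSUN_twisted hN hKp hKpR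
  have hV : OneLinkVarianceBound N R (Kp * K ^ 2) := (oneLinkVarianceBound_sdc (by omega) R hτ).mono le_rfl hK
  have h := oneLinkKRModulus_of_poincare_of_varianceBound (by positivity) (by positivity) hP hV
  have e : 1 / Kp * (Kp * K ^ 2) = K ^ 2 := by field_simp
  rw [e, Real.sqrt_sq hK0] at h
  exact h

/-- `SU(4)` AT the Bakry–Émery cap: `OneLinkKRModulus 4 (1/2) (15/2)` (`K_p = 15/64`, `τ = 7/5`; Bakry–Émery-based moduli do not exist at `R = 1/2`).
Recorded for completeness of the every-`N` column — far too large to close any door. [folklore] -/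
theorem su4_oneLinkKRModulus_twisted_half : OneLinkKRModulus 4 (1 / 2) (15 / 2) :=
  suN_oneLinkKRModulus_twisted_of_le (N := 4) (by norm_num) (τ := 7 / 5) (Kp := 15 / 64) (by norm_num) (by norm_num) (by norm_num) (by norm_num)
    (by norm_num)

end Summit.Ventures.YMGap.TwistedBochner

end
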